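import Literature.Dynamics.NBody.AlbouyKaloshin2012SymmetricCCsRoberts
import Literature.Dynamics.NBody.AlbouyKaloshin2012SliceBranchesComplex
import Literature.Dynamics.NBody.AlbouyKaloshin2012SymmetricCCsScaling

/-!
# Reflection-symmetric central configurations of `(1,1,1,1,1/4)`: the certificate interface

Topic `Literature/Dynamics/NBody`; `pub-smale6` cell, seat 1 gen 3. Composition of `roberts_reflSymmCCs_finite`
(`AlbouyKaloshin2012SymmetricCCsRoberts.lean`) with `t12BranchSet_finite_of_complex` / `t1234BranchSet_finite_of_complex`
(`AlbouyKaloshin2012SliceBranchesComplex.lean`): finiteness of ALL reflection-symmetric positive normalized central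
configurations ([AlbouyKaloshin2012] Definition 1) of the Roberts masses `(1,1,1,1,1/4)` follows from the finiteness of the
COMPLEX solution sets of three explicit polynomial systems — `T12(1,1/4)` on the sign branches `++++` and `+++−` (twelve
equations in twelve unknowns) and `T1234(1,1/4)` on `++` (eleven in eleven) — i.e. from exactly what a zero-dimensional
Gröbner-basis certificate over `ℚ` would establish. No such certificate is claimed here (the cell's mod-`p` Gröbner runs,
`run/shared/lean/pub/pub-smale6/certs/modgb/`, are evidence only).
-/

namespace Literature.Dynamics.NBody

/-- **Certificate interface for the Roberts masses.** Complex zero-dimensionality of `T12(1,1/4)` on `++++`, `+++−` and of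
`T1234(1,1/4)` on `++` implies that the reflection-symmetric positive normalized central configurations of `(1,1,1,1,1/4)`
are finite in number. [cite: AlbouyKaloshin2012, Remark 8 p. 583] -/
theorem roberts_reflSymmCCs_finite_of_complex
    (hA : (t12BranchSetC 1 1 1 1 1 (1 / 4)).Finite) (hB : (t12BranchSetC 1 1 1 (-1) 1 (1 / 4)).Finite)
    (hC : (t1234BranchSetC 1 1 1 (1 / 4)).Finite) :
    (reflSymmCCs (e32Masses 1 (1 / 4))).Finite :=
  roberts_reflSymmCCs_finite
    (t12BranchSet_finite_of_complex (by simpa using hA))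
    (t12BranchSet_finite_of_complex (by simpa using hB))
    (t1234BranchSet_finite_of_complex (by simpa using hC))

/-- The same statement for the masses `(4,4,4,4,1)` literally named in [AlbouyKaloshin2012] Remark 8 (mass scaling,
`reflSymmCCs_4441_finite_iff`). [cite: AlbouyKaloshin2012, Remark 8 p. 583] -/
theorem roberts4441_reflSymmCCs_finite_of_complex
    (hA : (t12BranchSetC 1 1 1 1 1 (1 / 4)).Finite) (hB : (t12BranchSetC 1 1 1 (-1) 1 (1 / 4)).Finite)
    (hC : (t1234BranchSetC 1 1 1 (1 / 4)).Finite) :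
    (reflSymmCCs ![4, 4, 4, 4, 1]).Finite :=
  reflSymmCCs_4441_finite_iff.mpr (roberts_reflSymmCCs_finite_of_complex hA hB hC)

end Literature.Dynamics.NBody
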